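import Summits.Ventures.Crystal3D.Bulk.PolarContraction
import Summits.Ventures.Crystal3D.Bulk.HalfTanBridge
import Summits.Ventures.Crystal3D.Bulk.GapWindow
import Literature.Geometry.DiscreteGeometry.KissingNumberThreeProofs
import HarnessLib

/-!
# Sphere-code bounds as CUTS: the exchange rate between "no 13 points pairwise ≥ θ₁" and hole radii

HONEST FRAMING. Part of the venture `Summits/Ventures/Crystal3D` (cell `pub-crystal3d`, phase 2,
24-hour decision sprint, `TARGET-GAP.md` §4.2/§4.2′ (U1)/P-L5′ and the lead's `DECISION-GAP`
template §2.U; seat typer-bulk). The census clears a WINDOW of hole radii and needs a CUT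
`ρ* < ρ_top` above it (`Bulk/GapWindow.lean`). Cuts come from thirteen-point SPHERE-CODE BOUNDS —
the tree's named fact `musinTarasov2012_tammes_thirteen` (chord `0.957`) or an exact SDP certificate
of the cell ("T13(θ₁)": no 13 unit vectors with pairwise inner products `≤ c₁ = cos θ₁`,
Bachoc–Vallentin-type, verified in exact arithmetic OUTSIDE Lean) — through the polar contraction
(`Bulk/PolarContraction.lean`, PROVED): a hole of radius `ρ` in a `60°`-code of twelve directions
contracts (factor `λ` about the antipode of the hole centre) to thirteen directions pairwise at
angle `≥ min (λ·60°, 180° − λ(180° − ρ))`. This file packages that as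

* the NAMED SHAPES of the cuts: `SphereCodeBoundInner c₁` (PRIMARY — the literal statement of the
  cell's certificates, `c₁` rational) and the chord form `SphereCodeBound s`
  (`= musinTarasov2012_tammes_thirteen` at `s = 0.957` by `Iff.rfl`; PROVED at `s = 1`:
  the kissing theorem); `sphereCodeBound_iff_inner`;
* THE WITNESS `PolarContraction.halfTanWitness_of_contraction`: under the pair condition
  `cos (λπ/3) ≤ 1 − s²/2` and the pole condition `s²/2 − 1 ≤ cos (λ(π − ρ₀))` (`κ ≤ cos ρ₀`) the
  contraction profile is a `TammesBridge.HalfTanWitness κ s` — the hypothesis of p3/idea-2's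
  `TammesBridge.noHole_of_halfTanWitness` (`Bulk/HalfTanBridge.lean`, in the tree), whose 13-point
  assembly is reused verbatim;
* THE EXCHANGE RATE `noHole_of_sphereCodeBoundInner` / `noHole_of_sphereCodeBound` /
  `noHole_cos_of_sphereCodeBoundInner`: a sphere-code bound plus the two `λ`-conditions IS a cut
  `NoHole κ` — with NO paper lemma in between; the optimal `λ = 180/(240 − ρ₀°)` reproduces
  `ρ_cut(θ₁) = 240° − 10800°/θ₁`, any admissible rational `λ` may be used;
* THE COMPOSITION with the window (`noHole_of_sphereCodeBoundInner_of_window`): certified top cut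
  + cleared window `[2 cos ρ₀, 2t]` ⇒ `NoHole t` — the typed referent of `DECISION-GAP` §2.U
  ("census of `[arccos t, ρ₀]` ×2 + exact top cut ⇒ GAP unconditional");
* a numerics-free sanity instance `halfTanWitness_half_one` (`λ = 1`, `s = 1`, `ρ₀ = 60°`: the kissing case);
* the CAP form of a cut (idea-2's codes-in-caps SDP lane): `CapCodeBound u₀` (no twelve-point
  `60°`-code inside a closed cap `⟪e, x⟫ ≥ u₀`) and `noHole_of_capCodeBound : CapCodeBound (−t) → NoHole t`
  — such a certificate is a cut DIRECTLY, with no exchange rate.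

Numeric instances (specific rational `c₁`, `λ`, `ρ₀` with certified `cos` enclosures) are NOT in
this file; no sphere-code bound is ASSERTED here except the proved `SphereCodeBound 1`.
-/

noncomputable section

open scoped BigOperators InnerProductSpace
open Finset Real Set

namespace Summit.Ventures.Crystal3D

open Literature.Geometry.DiscreteGeometry

/-! ## Thirteen-point sphere-code bounds: the named shapes of the cuts -/

/-- **Sphere-code bound, inner-product form** (PRIMARY; the literal shape of the cell's exact SDP
certificates `T13(θ₁)`, `c₁ = cos θ₁` rational, Bachoc–Vallentin-type): every finite set of unit
vectors of `ℝ³` whose pairwise inner products are all `≤ c₁` has at most twelve elements — there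
are no thirteen points of `S²` pairwise at angle `≥ arccos c₁`. NAMED SHAPE (a hypothesis to be
supplied by a certificate; nothing is asserted). -/
def SphereCodeBoundInner (c₁ : ℝ) : Prop :=
  ∀ T : Finset (EuclideanSpace ℝ (Fin 3)), (∀ v ∈ T, ‖v‖ = 1) →
    (∀ v ∈ T, ∀ w ∈ T, v ≠ w → ⟪v, w⟫_ℝ ≤ c₁) → T.card ≤ 12

/-- **Sphere-code bound, chord form**: every finite set of unit vectors of `ℝ³` with pairwise
Euclidean distances `≥ s` has at most twelve elements. At `s = 0.957` this is LITERALLY the tree's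
named fact `musinTarasov2012_tammes_thirteen` (`sphereCodeBound_0957_iff`); at `s = 1` it is the
PROVED kissing theorem `musin2006_kissing_three` (`sphereCodeBound_one`); it is the last hypothesis
of `TammesBridge.noHole_of_halfTanWitness`. -/
def SphereCodeBound (s : ℝ) : Prop :=
  ∀ T : Finset (EuclideanSpace ℝ (Fin 3)), (∀ v ∈ T, ‖v‖ = 1) →
    (∀ v ∈ T, ∀ w ∈ T, v ≠ w → s ≤ dist v w) → T.card ≤ 12

/-- `SphereCodeBound 0.957` is the tree's Tammes-13 named fact, by `Iff.rfl`. -/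
theorem sphereCodeBound_0957_iff : SphereCodeBound 0.957 ↔ musinTarasov2012_tammes_thirteen :=
  Iff.rfl

/-- `SphereCodeBound 1` HOLDS: the proved kissing theorem `musin2006_kissing_three_holds`. -/
theorem sphereCodeBound_one : SphereCodeBound 1 := fun T hT hd =>
  musin2006_kissing_three_holds T hT hd

/-- The chord form is MONOTONE in the chord: a bound at chord `s` gives the bound at every
`s' ≥ s`. -/
theorem SphereCodeBound.mono {s s' : ℝ} (h : s ≤ s') (hs : SphereCodeBound s) : SphereCodeBound s' :=
  fun T hT hd => hs T hT fun v hv w hw hvw => h.trans (hd v hv w hw hvw)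

/-- The inner form is ANTITONE in the cosine: a bound at `c₁` gives the bound at every `c₁' ≤ c₁`. -/
theorem SphereCodeBoundInner.anti {c₁ c₁' : ℝ} (h : c₁' ≤ c₁) (hc : SphereCodeBoundInner c₁) :
    SphereCodeBoundInner c₁' :=
  fun T hT hd => hc T hT fun v hv w hw hvw => (hd v hv w hw hvw).trans h

/-- For unit vectors, `s ≤ dist v w ↔ ⟪v, w⟫ ≤ 1 − s²/2` when `0 ≤ s` (`‖v − w‖² = 2 − 2⟪v, w⟫`). -/
theorem le_dist_iff_inner_le {v w : EuclideanSpace ℝ (Fin 3)} (hv : ‖v‖ = 1) (hw : ‖w‖ = 1)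
    {s : ℝ} (hs : 0 ≤ s) : s ≤ dist v w ↔ ⟪v, w⟫_ℝ ≤ 1 - s ^ 2 / 2 := by
  have hsq : dist v w ^ 2 = 2 - 2 * ⟪v, w⟫_ℝ := by
    rw [dist_eq_norm, norm_sub_sq_real, hv, hw]; ring
  constructor
  · intro h
    have h2 : s ^ 2 ≤ dist v w ^ 2 := pow_le_pow_left₀ hs h 2
    rw [hsq] at h2
    linarith
  · intro h
    have h2 : s ^ 2 ≤ dist v w ^ 2 := by rw [hsq]; linarith
    exact (pow_le_pow_iff_left₀ hs dist_nonneg two_ne_zero).1 h2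

/-- **Chord form ⇔ inner form**: `SphereCodeBound s ↔ SphereCodeBoundInner (1 − s²/2)` for `s ≥ 0`.
-/
theorem sphereCodeBound_iff_inner {s : ℝ} (hs : 0 ≤ s) :
    SphereCodeBound s ↔ SphereCodeBoundInner (1 - s ^ 2 / 2) := by
  constructor
  · intro h T hT hd
    exact h T hT fun v hv w hw hvw => (le_dist_iff_inner_le (hT v hv) (hT w hw) hs).2 (hd v hv w hw hvw)
  · intro h T hT hd
    exact h T hT fun v hv w hw hvw => (le_dist_iff_inner_le (hT v hv) (hT w hw) hs).1 (hd v hv w hw hvw)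

/-- **Inner form ⇒ chord form at the matching chord** `s = √(2 − 2c₁)` (`c₁ ≤ 1`). -/
theorem SphereCodeBoundInner.sphereCodeBound {c₁ : ℝ} (hc₁ : c₁ ≤ 1) (h : SphereCodeBoundInner c₁) :
    SphereCodeBound (Real.sqrt (2 - 2 * c₁)) := by
  rw [sphereCodeBound_iff_inner (Real.sqrt_nonneg _), Real.sq_sqrt (by linarith)]
  rw [show 1 - (2 - 2 * c₁) / 2 = c₁ by ring]
  exact h

/-! ## Codes in caps (the shape of idea-2's cap-SDP cuts): a cut with no exchange rate -/

/-- **Cap-code bound** (the literal shape of the cell's codes-in-caps SDP certificates, idea-2,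
Bachoc–Vallentin 2009-type): for every unit vector `e` ("cap centre"), every finite set of unit
vectors of `ℝ³` with pairwise inner products `≤ 1/2` (a `60°`-code) all lying in the closed cap
`{x : u₀ ≤ ⟪e, x⟫}` has at most ELEVEN elements. NAMED SHAPE (a hypothesis to be supplied by a
certificate `V(d, u₀) < 12`; nothing is asserted). -/
def CapCodeBound (u₀ : ℝ) : Prop :=
  ∀ e : EuclideanSpace ℝ (Fin 3), ‖e‖ = 1 →
    ∀ T : Finset (EuclideanSpace ℝ (Fin 3)), (∀ v ∈ T, ‖v‖ = 1) →
      (∀ v ∈ T, ∀ w ∈ T, v ≠ w → ⟪v, w⟫_ℝ ≤ 1 / 2) → (∀ v ∈ T, u₀ ≤ ⟪e, v⟫_ℝ) → T.card ≤ 11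

/-- The cap-code bound is MONOTONE in the cap level: a bound for the cap `⟪e, x⟫ ≥ u₀` gives the
bound for every smaller cap `⟪e, x⟫ ≥ u₀' ≥ u₀`. -/
theorem CapCodeBound.mono {u₀ u₀' : ℝ} (h : u₀ ≤ u₀') (hc : CapCodeBound u₀) : CapCodeBound u₀' :=
  fun e he T hT hsep hcap => hc e he T hT hsep fun v hv => h.trans (hcap v hv)

/-- **A cap-code bound IS a cut, with no exchange rate**: `CapCodeBound (−t) → NoHole t`. A hole
`(x, p)` at cosine level `t` (`⟪p, xᵢ⟫ ≤ t` for all twelve shell directions) is a twelve-point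
`60°`-code inside the closed cap of centre `e = −p` and level `−t`. So idea-2's exact certificate
«`V(d, −cos ρ₁) < 12`» enters `Bulk/GapWindow.lean` directly as `NoHole (cos ρ₁)`. -/
theorem noHole_of_capCodeBound {t : ℝ} (hc : CapCodeBound (-t)) : NoHole t := by
  classical
  intro x p hx hp hxx
  by_contra hall
  push Not at hall
  have hxinj : Function.Injective x := by
    intro i j hij
    by_contra hne
    have h := hxx i j hne
    rw [hij, real_inner_self_eq_norm_sq, hx j] at h
    norm_num at h
  set T : Finset (EuclideanSpace ℝ (Fin 3)) := univ.image x with hT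
  have hcard : T.card = 12 := by
    rw [hT, card_image_of_injective _ hxinj, card_univ, Fintype.card_fin]
  have hunit : ∀ v ∈ T, ‖v‖ = 1 := by
    intro v hv
    rw [hT] at hv
    obtain ⟨i, -, rfl⟩ := mem_image.1 hv
    exact hx i
  have hsep : ∀ v ∈ T, ∀ w ∈ T, v ≠ w → ⟪v, w⟫_ℝ ≤ 1 / 2 := by
    intro v hv w hw hvw
    rw [hT] at hv hw
    obtain ⟨i, -, rfl⟩ := mem_image.1 hv
    obtain ⟨j, -, rfl⟩ := mem_image.1 hw
    exact hxx i j fun h => hvw (by rw [h])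
  have hcap : ∀ v ∈ T, -t ≤ ⟪-p, v⟫_ℝ := by
    intro v hv
    rw [hT] at hv
    obtain ⟨i, -, rfl⟩ := mem_image.1 hv
    rw [inner_neg_left]
    linarith [hall i]
  have h11 := hc (-p) (by rw [norm_neg, hp]) T hunit hsep hcap
  omega

/-! ## The witness: the contraction profile satisfies the half-tangent bounds -/

namespace PolarContraction

/-- **THE WITNESS.** For `0 ≤ λ ≤ 1`, `ρ₀ ∈ [0, π]` with `κ ≤ cos ρ₀` (every admissible shell
direction has polar angle `≤ π − ρ₀` about the antipode of the hole centre), the PAIR CONDITION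
`cos (λ · π/3) ≤ 1 − s²/2` (two shell directions `≥ 60°` apart contract to directions at chord
`≥ s`) and the POLE CONDITION `s²/2 − 1 ≤ cos (λ(π − ρ₀))` (a contracted direction stays at chord
`≥ s` from the hole centre), the contraction profile is a `TammesBridge.HalfTanWitness κ s`
(the hypothesis of `TammesBridge.noHole_of_halfTanWitness`, `Bulk/HalfTanBridge.lean`). This is the
Böröczky–Szabó exchange rate (RANGE-CUT.md §1–§2; TARGET-GAP (U1)/P-L5′) with a free `λ`; the
optimal `λ = π/(4π/3 − ρ₀)` equalises the two conditions. -/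
theorem halfTanWitness_of_contraction {lam κ s ρ₀ : ℝ} (h0 : 0 ≤ lam) (h1 : lam ≤ 1)
    (hρ₀ : 0 ≤ ρ₀) (hρπ : ρ₀ ≤ π) (hκ : κ ≤ cos ρ₀) (hpair : cos (lam * (π / 3)) ≤ 1 - s ^ 2 / 2)
    (hpole : s ^ 2 / 2 - 1 ≤ cos (lam * (π - ρ₀))) : TammesBridge.HalfTanWitness κ s := by
  refine ⟨contractProfile lam, contractProfile_nonneg h0 h1, contractProfile_zero lam, ?_, ?_⟩
  · -- POLE BOUND
    intro w hw hadm
    -- the polar angle θ = 2 arctan w ∈ [0, π) and its cosine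
    set a : ℝ := arctan w with ha
    have ha0 : 0 ≤ a := arctan_nonneg.2 hw
    have haπ : a < π / 2 := arctan_lt_pi_div_two w
    have hcosa : cos a ≠ 0 := (cos_arctan_pos w).ne'
    have htan : tan a = w := tan_arctan w
    have e1 : 1 - w ^ 2 = cos (2 * a) * (1 + w ^ 2) := by rw [← htan]; exact one_sub_tan_sq a hcosa
    -- cos θ ≥ -κ ≥ -cos ρ₀ = cos (π - ρ₀), hence θ ≤ π - ρ₀
    have hcosθ : cos (π - ρ₀) ≤ cos (2 * a) := by
      rw [cos_pi_sub]
      have hpos : 0 < 1 + w ^ 2 := by positivity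
      by_contra hlt
      push Not at hlt
      have : cos (2 * a) * (1 + w ^ 2) < -κ * (1 + w ^ 2) :=
        mul_lt_mul_of_pos_right (by linarith) hpos
      rw [← e1] at this
      nlinarith
    have hθle : 2 * a ≤ π - ρ₀ := by
      by_contra hlt
      push Not at hlt
      have := cos_lt_cos_of_nonneg_of_le_pi (by linarith) (by linarith) hlt
      linarith
    -- the contracted angle and its cosine
    have hF : contractProfile lam w = tan (lam * a) := by
      rw [contractProfile, max_eq_left hw]
    obtain ⟨hb0, hb1⟩ := contract_angle_mem h0 h1 w
    rw [max_eq_left hw, ← ha] at hb0 hb1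
    have hcosb : cos (lam * a) ≠ 0 :=
      (cos_pos_of_mem_Ioo ⟨by linarith [pi_pos], hb1⟩).ne'
    have e2 : 1 - tan (lam * a) ^ 2 = cos (2 * (lam * a)) * (1 + tan (lam * a) ^ 2) :=
      one_sub_tan_sq _ hcosb
    have hcos2 : s ^ 2 / 2 - 1 ≤ cos (2 * (lam * a)) := by
      refine hpole.trans ?_
      rw [show 2 * (lam * a) = lam * (2 * a) by ring]
      apply cos_le_cos_of_nonneg_of_le_pi
      · exact mul_nonneg h0 (by linarith)
      · calc lam * (π - ρ₀) ≤ 1 * (π - ρ₀) := mul_le_mul_of_nonneg_right h1 (by linarith)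
          _ ≤ π := by linarith
      · exact mul_le_mul_of_nonneg_left hθle h0
    rw [hF]
    have hW2 : 0 ≤ 1 + tan (lam * a) ^ 2 := by positivity
    have := mul_le_mul_of_nonneg_right hcos2 hW2
    rw [← e2] at this
    nlinarith [sq_nonneg (tan (lam * a)), sq_nonneg s]
  · -- PAIR BOUND
    intro w₁ w₂ c hw₁ hw₂ _hadm₁ _hadm₂ hc1 hc2 hprem
    set a₁ : ℝ := arctan w₁ with ha₁
    set a₂ : ℝ := arctan w₂ with ha₂
    have ha₁0 : 0 ≤ a₁ := arctan_nonneg.2 hw₁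
    have ha₂0 : 0 ≤ a₂ := arctan_nonneg.2 hw₂
    have ha₁π : a₁ < π / 2 := arctan_lt_pi_div_two w₁
    have ha₂π : a₂ < π / 2 := arctan_lt_pi_div_two w₂
    have e1 : 1 - w₁ ^ 2 = cos (2 * a₁) * (1 + w₁ ^ 2) := by
      rw [← tan_arctan w₁]; exact one_sub_tan_sq a₁ (cos_arctan_pos w₁).ne'
    have e2 : 1 - w₂ ^ 2 = cos (2 * a₂) * (1 + w₂ ^ 2) := by
      rw [← tan_arctan w₂]; exact one_sub_tan_sq a₂ (cos_arctan_pos w₂).ne'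
    have f1 : 2 * w₁ = sin (2 * a₁) * (1 + w₁ ^ 2) := by
      rw [← tan_arctan w₁]; exact two_mul_tan a₁ (cos_arctan_pos w₁).ne'
    have f2 : 2 * w₂ = sin (2 * a₂) * (1 + w₂ ^ 2) := by
      rw [← tan_arctan w₂]; exact two_mul_tan a₂ (cos_arctan_pos w₂).ne'
    -- the original inner product u ≤ 1/2
    set u : ℝ := cos (2 * a₁) * cos (2 * a₂) + sin (2 * a₁) * sin (2 * a₂) * c with hu
    have hP : 0 < (1 + w₁ ^ 2) * (1 + w₂ ^ 2) := by positivity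
    have key : (1 - w₁ ^ 2) * (1 - w₂ ^ 2) + 4 * w₁ * w₂ * c = u * ((1 + w₁ ^ 2) * (1 + w₂ ^ 2)) := by
      rw [show (4 : ℝ) * w₁ * w₂ * c = (2 * w₁) * (2 * w₂) * c by ring, e1, e2, f1, f2, hu]
      ring
    have hu12 : u ≤ 1 / 2 := by
      rw [key] at hprem
      exact le_of_mul_le_mul_right hprem hP
    -- the contracted side
    have hF1 : contractProfile lam w₁ = tan (lam * a₁) := by rw [contractProfile, max_eq_left hw₁]
    have hF2 : contractProfile lam w₂ = tan (lam * a₂) := by rw [contractProfile, max_eq_left hw₂]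
    obtain ⟨hb₁0, hb₁1⟩ := contract_angle_mem h0 h1 w₁
    obtain ⟨hb₂0, hb₂1⟩ := contract_angle_mem h0 h1 w₂
    rw [max_eq_left hw₁, ← ha₁] at hb₁0 hb₁1
    rw [max_eq_left hw₂, ← ha₂] at hb₂0 hb₂1
    have hcb₁ : cos (lam * a₁) ≠ 0 := (cos_pos_of_mem_Ioo ⟨by linarith [pi_pos], hb₁1⟩).ne'
    have hcb₂ : cos (lam * a₂) ≠ 0 := (cos_pos_of_mem_Ioo ⟨by linarith [pi_pos], hb₂1⟩).ne'
    have g1 : 1 - tan (lam * a₁) ^ 2 = cos (2 * (lam * a₁)) * (1 + tan (lam * a₁) ^ 2) :=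
      one_sub_tan_sq _ hcb₁
    have g2 : 1 - tan (lam * a₂) ^ 2 = cos (2 * (lam * a₂)) * (1 + tan (lam * a₂) ^ 2) :=
      one_sub_tan_sq _ hcb₂
    have k1 : 2 * tan (lam * a₁) = sin (2 * (lam * a₁)) * (1 + tan (lam * a₁) ^ 2) :=
      two_mul_tan _ hcb₁
    have k2 : 2 * tan (lam * a₂) = sin (2 * (lam * a₂)) * (1 + tan (lam * a₂) ^ 2) :=
      two_mul_tan _ hcb₂
    set L : ℝ := cos (2 * (lam * a₁)) * cos (2 * (lam * a₂)) +
      sin (2 * (lam * a₁)) * sin (2 * (lam * a₂)) * c with hL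
    have key' : (1 - tan (lam * a₁) ^ 2) * (1 - tan (lam * a₂) ^ 2) +
        4 * tan (lam * a₁) * tan (lam * a₂) * c =
        L * ((1 + tan (lam * a₁) ^ 2) * (1 + tan (lam * a₂) ^ 2)) := by
      rw [show (4 : ℝ) * tan (lam * a₁) * tan (lam * a₂) * c =
        (2 * tan (lam * a₁)) * (2 * tan (lam * a₂)) * c by ring, g1, g2, k1, k2, hL]
      ring
    -- the contraction inequality: L ≤ cos (λ · arccos u) ≤ cos (λ π/3) ≤ 1 - s²/2
    have hθ₁ : 2 * a₁ ∈ Icc 0 π := ⟨by linarith, by linarith⟩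
    have hθ₂ : 2 * a₂ ∈ Icc 0 π := ⟨by linarith, by linarith⟩
    have hcontr := inner_contract_le (c := c) h0 h1 hθ₁ hθ₂ ⟨hc1, hc2⟩
    rw [show lam * (2 * a₁) = 2 * (lam * a₁) by ring, show lam * (2 * a₂) = 2 * (lam * a₂) by ring,
      ← hu] at hcontr
    have hT : T lam u ≤ 1 - s ^ 2 / 2 := by
      refine le_trans ?_ hpair
      simp only [T]
      apply cos_le_cos_of_nonneg_of_le_pi
      · exact mul_nonneg h0 (by positivity)
      · calc lam * arccos u ≤ 1 * arccos u := mul_le_mul_of_nonneg_right h1 (arccos_nonneg u)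
          _ ≤ π := by rw [one_mul]; exact arccos_le_pi u
      · apply mul_le_mul_of_nonneg_left _ h0
        rw [← arccos_one_half]
        exact arccos_le_arccos hu12
    have hLle : L ≤ 1 - s ^ 2 / 2 := (hL ▸ hcontr).trans hT
    rw [hF1, hF2, key']
    exact mul_le_mul_of_nonneg_right hLle (by positivity)

end PolarContraction

/-! ## The exchange rate: a sphere-code bound is a cut -/

/-- **EXCHANGE RATE, chord form.** Let `0 ≤ λ ≤ 1`, `ρ₀ ∈ [0, π]`, `κ ≤ cos ρ₀`, `κ < 1`, `0 < s`,
with the pair condition `cos (λ·π/3) ≤ 1 − s²/2` and the pole condition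
`s²/2 − 1 ≤ cos (λ(π − ρ₀))`. If NO thirteen unit vectors of `ℝ³` are pairwise at distance `≥ s`
(`SphereCodeBound s`), then `NoHole κ`: every shell of twelve `60°`-separated directions has a
direction within angle `< arccos κ` of every `p` — in particular (taking `κ = cos ρ₀`) the extremal
hole radius satisfies `ρ* < ρ₀`. Composition of `PolarContraction.halfTanWitness_of_contraction`
with `TammesBridge.noHole_of_halfTanWitness` (p3 / idea-2, `Bulk/HalfTanBridge.lean`). -/
theorem noHole_of_sphereCodeBound {lam κ s ρ₀ : ℝ} (h0 : 0 ≤ lam) (h1 : lam ≤ 1) (hρ₀ : 0 ≤ ρ₀)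
    (hρπ : ρ₀ ≤ π) (hκ : κ ≤ cos ρ₀) (hκ1 : κ < 1) (hs : 0 < s)
    (hpair : cos (lam * (π / 3)) ≤ 1 - s ^ 2 / 2) (hpole : s ^ 2 / 2 - 1 ≤ cos (lam * (π - ρ₀)))
    (hT : SphereCodeBound s) : NoHole κ :=
  TammesBridge.noHole_of_halfTanWitness hκ1 hs
    (PolarContraction.halfTanWitness_of_contraction h0 h1 hρ₀ hρπ hκ hpair hpole) hT

/-- **EXCHANGE RATE, inner-product form** (the shape of the cell's certified top cuts): with
`c₁ < 1` the cosine of the code angle, `cos (λ·π/3) ≤ c₁` (pairs) and `−c₁ ≤ cos (λ(π − ρ₀))`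
(pole), `SphereCodeBoundInner c₁ → NoHole κ` for every `κ ≤ cos ρ₀`, `κ < 1`. With the optimal
`λ = 180/(240 − ρ₀°)` the two conditions read `ρ₀ ≥ ρ_cut(θ₁) = 240° − 10800°/θ₁`, `θ₁ = arccos c₁`
(`TARGET-GAP.md` (U1)); any rational `λ` satisfying both may be used. -/
theorem noHole_of_sphereCodeBoundInner {lam κ c₁ ρ₀ : ℝ} (h0 : 0 ≤ lam) (h1 : lam ≤ 1)
    (hρ₀ : 0 ≤ ρ₀) (hρπ : ρ₀ ≤ π) (hκ : κ ≤ cos ρ₀) (hκ1 : κ < 1) (hc₁ : c₁ < 1)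
    (hpair : cos (lam * (π / 3)) ≤ c₁) (hpole : -c₁ ≤ cos (lam * (π - ρ₀)))
    (hT : SphereCodeBoundInner c₁) : NoHole κ := by
  have hs : 0 < Real.sqrt (2 - 2 * c₁) := Real.sqrt_pos.2 (by linarith)
  have hs2 : Real.sqrt (2 - 2 * c₁) ^ 2 = 2 - 2 * c₁ := Real.sq_sqrt (by linarith)
  refine noHole_of_sphereCodeBound h0 h1 hρ₀ hρπ hκ hκ1 hs ?_ ?_ (hT.sphereCodeBound hc₁.le)
  · rw [hs2]; linarith
  · rw [hs2]; linarith

/-- **The cut in the form `Bulk/GapWindow.lean` consumes**, at `κ = cos ρ₀`: a certified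
`SphereCodeBoundInner c₁` plus the two `λ`-conditions give `NoHole (cos ρ₀)`, i.e. `ρ* < ρ₀`
(`0 < ρ₀ ≤ π`). -/
theorem noHole_cos_of_sphereCodeBoundInner {lam c₁ ρ₀ : ℝ} (h0 : 0 ≤ lam) (h1 : lam ≤ 1)
    (hρ₀ : 0 < ρ₀) (hρπ : ρ₀ ≤ π) (hc₁ : c₁ < 1) (hpair : cos (lam * (π / 3)) ≤ c₁)
    (hpole : -c₁ ≤ cos (lam * (π - ρ₀))) (hT : SphereCodeBoundInner c₁) : NoHole (cos ρ₀) := by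
  have hlt : cos ρ₀ < 1 := by
    rw [← cos_zero]
    exact cos_lt_cos_of_nonneg_of_le_pi le_rfl hρπ hρ₀
  exact noHole_of_sphereCodeBoundInner h0 h1 hρ₀.le hρπ le_rfl hlt hc₁ hpair hpole hT

/-- **The kissing case recovered** (sanity instance, no numerics): with `λ = 1`, `ρ₀ = π/3`,
`κ = 1/2`, `s = 1` both conditions are equalities (`cos 60° = 1/2 = 1 − 1/2`, `cos 120° = −1/2`),
so the identity contraction is a `HalfTanWitness (1/2) 1`; with `sphereCodeBound_one` this
re-proves `NoHole (1/2)` (`noHole_half` of `Bulk/GapWindow.lean`, proved there directly — not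
restated here). -/
theorem halfTanWitness_half_one : TammesBridge.HalfTanWitness (1 / 2) 1 :=
  PolarContraction.halfTanWitness_of_contraction (lam := 1) (κ := 1 / 2) (s := 1) (ρ₀ := π / 3)
    zero_le_one le_rfl (by positivity) (by linarith [pi_pos]) (by rw [cos_pi_div_three])
    (by rw [one_mul, cos_pi_div_three]; norm_num)
    (by rw [one_mul, cos_pi_sub, cos_pi_div_three]; norm_num)

/-! ## Composition with the window census -/

/-- **TOP CUT + WINDOW ⇒ GAP** (the typed referent of `DECISION-GAP` §2.U): a certified
sphere-code bound `SphereCodeBoundInner c₁` with admissible `λ` for the radius `ρ₀`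
(`cos (λπ/3) ≤ c₁`, `−c₁ ≤ cos (λ(π − ρ₀))`), together with the cleared window `[2 cos ρ₀, 2t]` of
intruder distances (hole radii `[arccos t, ρ₀]` — the census ×2), gives `NoHole t` (`t ≥ 1/2`).
At `t = 0.63` this is GAP(1.26) with the label UNCONDITIONAL modulo the two certified computations.
-/
theorem noHole_of_sphereCodeBoundInner_of_window {lam c₁ ρ₀ t : ℝ} (h0 : 0 ≤ lam) (h1 : lam ≤ 1)
    (hρ₀ : 0 < ρ₀) (hρπ : ρ₀ ≤ π) (hc₁ : c₁ < 1) (hpair : cos (lam * (π / 3)) ≤ c₁)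
    (hpole : -c₁ ≤ cos (lam * (π - ρ₀))) (hT : SphereCodeBoundInner c₁) (ht : 1 / 2 ≤ t)
    (hwin : ExtremalFreeWindow (2 * cos ρ₀) (2 * t)) : NoHole t :=
  noHole_of_noHole_of_extremalFreeWindow ht
    (noHole_cos_of_sphereCodeBoundInner h0 h1 hρ₀ hρπ hc₁ hpair hpole hT) hwin

end Summit.Ventures.Crystal3D

end
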